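import Literature.Computability.MetaComplexity.ParityAlgCubeLift
import Literature.Computability.Complexity.SumOfSquaresRefutationDuality
import HarnessLib

/-!
# Pseudoexpectations by substitution into a Grigoriev–Schoenebeck moment functional

Grigoriev 2001, Lemma 9 ("Suppose that `P` is `(d₁, d₂)`-reducible to `Q`. Then if there is a
degree `d₃` `PC>` refutation of `Q` then there is a degree `max{d₂, d₃ d₁}` `PC>` refutation of
`P`"), in the DUAL, static form the tree uses: a substitution of the variables of a polynomial
system `Sys` (over any variable type `σ`) by elements `S e ∈ ParityAlg` of support size `≤ Δ`
turns the moment functional `L = momentFunctional (pseudoMoment g b r d)` of an expanding XOR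
system (`XorDerivation.lean`, `XorPseudoexpectation.lean`) into the linear functional
`E(p) = L(p(S))` on `ℝ[X_σ]` (`substFunctional`), and

* `E 1 = 1` (`substFunctional_one`);
* `E (q²) ≥ 0` whenever `2 Δ deg q ≤ d` (`substFunctional_mul_self_nonneg`, from
  `pseudoMoment_quadratic_nonneg` and the support bound `cardSuppLE_aeval`);
* `E (g' · P) = 0` when `P(S) = 0` in `ParityAlg` (`substFunctional_mul_eq_zero_of_aeval_eq_zero`)
  or when `P(S) = a · (1 + y_D) · w` with `y_D = -1` one of the XOR equations and `w`, `g'` of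
  small support/degree (`substFunctional_mul_eq_zero_of_parity`, from
  `momentFunctional_one_add_yMon_mul`);

so that, by weak duality (`not_hasSOSRefutation_of_pseudoexpectation`), a system each of whose
equations is of one of these two kinds under the substitution has no static SOS refutation of
half-degree `d'` with `2 Δ (d' + 1) + |D| ≤ d` (`not_hasSOSRefutation_of_substitution`). The
support-size predicate `CardSuppLE k z` ("every monomial `y_T` of `z` has `|T| ≤ k`") and its
calculus (`.add`, `.mul`, `.prod`, `cardSuppLE_aeval`) are the degree bookkeeping of Lemma 9.

## References

* D. Grigoriev, *Linear lower bound on degrees of Positivstellensatz calculus proofs for the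
  parity*, Theoret. Comput. Sci. 259 (2001) 613–622, Def. 8, Lemma 9. [Grigoriev2001TCS]
* S. Buss, D. Grigoriev, R. Impagliazzo, T. Pitassi, *Linear gaps between degrees for the
  polynomial calculus modulo distinct primes*, JCSS 62 (2001), §7.
-/

noncomputable section

open Finset MvPolynomial
open scoped symmDiff

namespace Literature.Computability.MetaComplexity

/-! ### Support-size bounds in `ParityAlg` -/

/-- `CardSuppLE k z`: every monomial `y_T` occurring in `z ∈ ParityAlg` has `|T| ≤ k` (the
"degree `≤ k`" of a multilinear `±1` polynomial). [cite: Grigoriev2001TCS, Def. 8 (degree of the substitution polynomials)] -/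
def CardSuppLE (k : ℕ) (z : ParityAlg) : Prop :=
  ∀ T ∈ z.coeff.support, T.support.card ≤ k

/-- Monotonicity in the bound. [cite: Grigoriev2001TCS, Lemma 9 (proof)] -/
theorem CardSuppLE.mono {k k' : ℕ} {z : ParityAlg} (h : CardSuppLE k z) (hk : k ≤ k') :
    CardSuppLE k' z :=
  fun T hT => (h T hT).trans hk

/-- A window bound gives a size bound. [cite: Grigoriev2001TCS, Lemma 9 (proof)] -/
theorem SuppIn.cardSuppLE {B : Finset ℕ} {z : ParityAlg} (h : SuppIn B z) : CardSuppLE B.card z :=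
  fun _ hT => h.card_support_le hT

/-- `0` has every bound. [cite: Grigoriev2001TCS, Lemma 9 (proof)] -/
theorem cardSuppLE_zero (k : ℕ) : CardSuppLE k 0 := by
  intro T hT
  simp at hT

/-- `single T a` is bounded by `|T|`. [cite: Grigoriev2001TCS, Lemma 9 (proof)] -/
theorem cardSuppLE_single (T : ParityVec) (a : ℝ) :
    CardSuppLE T.support.card (AddMonoidAlgebra.single T a) := by
  intro U hU
  rw [AddMonoidAlgebra.coeff_single] at hU
  have := Finsupp.support_single_subset hU
  rw [Finset.mem_singleton] at this
  rw [this]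

/-- Scalars have bound `0`. [cite: Grigoriev2001TCS, Lemma 9 (proof)] -/
theorem cardSuppLE_algebraMap (a : ℝ) : CardSuppLE 0 (algebraMap ℝ ParityAlg a) := by
  rw [AddMonoidAlgebra.coe_algebraMap, Function.comp_apply, Algebra.algebraMap_self_apply]
  simpa using cardSuppLE_single 0 a

/-- `1` has bound `0`. [cite: Grigoriev2001TCS, Lemma 9 (proof)] -/
theorem cardSuppLE_one : CardSuppLE 0 (1 : ParityAlg) := by
  rw [AddMonoidAlgebra.one_def]
  simpa using cardSuppLE_single 0 1

/-- Sums. [cite: Grigoriev2001TCS, Lemma 9 (proof)] -/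
theorem CardSuppLE.add {k : ℕ} {x z : ParityAlg} (hx : CardSuppLE k x) (hz : CardSuppLE k z) :
    CardSuppLE k (x + z) := by
  intro T hT
  rw [AddMonoidAlgebra.coeff_add] at hT
  rcases Finset.mem_union.1 (Finsupp.support_add hT) with h | h
  · exact hx T h
  · exact hz T h

/-- Scalar multiples. [cite: Grigoriev2001TCS, Lemma 9 (proof)] -/
theorem CardSuppLE.smul {k : ℕ} {x : ParityAlg} (hx : CardSuppLE k x) (a : ℝ) :
    CardSuppLE k (a • x) := by
  intro T hT
  rw [AddMonoidAlgebra.coeff_smul] at hT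
  exact hx T (Finsupp.support_smul hT)

/-- Negation. [cite: Grigoriev2001TCS, Lemma 9 (proof)] -/
theorem CardSuppLE.neg {k : ℕ} {x : ParityAlg} (hx : CardSuppLE k x) : CardSuppLE k (-x) := by
  rw [← neg_one_smul ℝ x]
  exact hx.smul _

/-- Differences. [cite: Grigoriev2001TCS, Lemma 9 (proof)] -/
theorem CardSuppLE.sub {k : ℕ} {x z : ParityAlg} (hx : CardSuppLE k x) (hz : CardSuppLE k z) :
    CardSuppLE k (x - z) := by
  rw [sub_eq_add_neg]
  exact hx.add hz.neg

/-- Finite sums. [cite: Grigoriev2001TCS, Lemma 9 (proof)] -/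
theorem CardSuppLE.sum {κ : Type*} {k : ℕ} {s : Finset κ} {f : κ → ParityAlg}
    (h : ∀ i ∈ s, CardSuppLE k (f i)) : CardSuppLE k (∑ i ∈ s, f i) := by
  classical
  induction s using Finset.induction_on with
  | empty => rw [sum_empty]; exact cardSuppLE_zero k
  | insert a s ha ih =>
    rw [Finset.sum_insert ha]
    exact (h a (Finset.mem_insert_self a s)).add (ih fun i hi => h i (Finset.mem_insert_of_mem hi))

/-- Products: bounds add (`y_T y_U = y_{T+U}`, `|supp (T+U)| ≤ |supp T| + |supp U|`).
[cite: Grigoriev2001TCS, Lemma 9 (proof)] -/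
theorem CardSuppLE.mul {k₁ k₂ : ℕ} {x z : ParityAlg} (hx : CardSuppLE k₁ x) (hz : CardSuppLE k₂ z) :
    CardSuppLE (k₁ + k₂) (x * z) := by
  classical
  intro T hT
  have := AddMonoidAlgebra.support_coeff_mul_subset x z hT
  rw [Finset.mem_add] at this
  obtain ⟨T₁, hT₁, T₂, hT₂, rfl⟩ := this
  exact (card_support_add_le T₁ T₂).trans (Nat.add_le_add (hx T₁ hT₁) (hz T₂ hT₂))

/-- Powers. [cite: Grigoriev2001TCS, Lemma 9 (proof)] -/
theorem CardSuppLE.pow {k : ℕ} {x : ParityAlg} (hx : CardSuppLE k x) :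
    ∀ n : ℕ, CardSuppLE (n * k) (x ^ n)
  | 0 => by rw [pow_zero, zero_mul]; exact cardSuppLE_one
  | n + 1 => by
    rw [pow_succ, add_mul, one_mul]
    exact (hx.pow n).mul hx

/-- Finite products: bounds add up. [cite: Grigoriev2001TCS, Lemma 9 (proof)] -/
theorem CardSuppLE.prod {κ : Type*} [DecidableEq κ] {k : κ → ℕ} {s : Finset κ}
    {f : κ → ParityAlg} (h : ∀ i ∈ s, CardSuppLE (k i) (f i)) :
    CardSuppLE (∑ i ∈ s, k i) (∏ i ∈ s, f i) := by
  induction s using Finset.induction_on with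
  | empty => rw [prod_empty, sum_empty]; exact cardSuppLE_one
  | insert a s ha ih =>
    rw [Finset.prod_insert ha, Finset.sum_insert ha]
    exact (h a (Finset.mem_insert_self a s)).mul (ih fun i hi => h i (Finset.mem_insert_of_mem hi))

/-- **Degree control of a substitution.** If every `S e` has monomials of size `≤ Δ`, then every
monomial of `q(S)` has size `≤ Δ · deg q` ("`deg Q(s₁,…,s_m) ≤ d₁ · deg Q`").
[cite: Grigoriev2001TCS, Lemma 9 (proof: degree of the substituted refutation)] -/
theorem cardSuppLE_aeval {σ : Type*} (S : σ → ParityAlg) {Δ : ℕ} (hS : ∀ e, CardSuppLE Δ (S e))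
    (q : MvPolynomial σ ℝ) : CardSuppLE (Δ * q.totalDegree) (MvPolynomial.aeval S q) := by
  classical
  have hq : MvPolynomial.aeval S q = ∑ α ∈ q.support, MvPolynomial.aeval S (monomial α (coeff α q)) := by
    conv_lhs => rw [q.as_sum]
    rw [map_sum]
  rw [hq]
  refine CardSuppLE.sum fun α hα => ?_
  rw [MvPolynomial.aeval_monomial, Finsupp.prod]
  have h1 : CardSuppLE 0 (algebraMap ℝ ParityAlg (coeff α q)) := cardSuppLE_algebraMap _
  have h2 : CardSuppLE (∑ e ∈ α.support, α e * Δ) (∏ e ∈ α.support, S e ^ α e) :=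
    CardSuppLE.prod fun e _ => (hS e).pow (α e)
  have h3 := h1.mul h2
  rw [zero_add] at h3
  refine h3.mono ?_
  rw [← Finset.sum_mul, mul_comm]
  exact Nat.mul_le_mul_left _ (MvPolynomial.le_totalDegree hα)

/-! ### The substituted functional -/

section Subst

variable {ι : Type*} (g : ι → ParityVec) (b : ι → ℝ) (r : ℝ) (d : ℕ)
variable {σ : Type*} (S : σ → ParityAlg)

/-- **The pseudoexpectation of a reduction**: `E(p) = L(p(S))`, `L` the Grigoriev–Schoenebeck
moment functional of the XOR system `(g, b)` at radius `r`, degree `d`, and `p(S)` the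
substitution `X_e ↦ S e ∈ ParityAlg`. [cite: Grigoriev2001TCS, Lemma 9] -/
def substFunctional : MvPolynomial σ ℝ →ₗ[ℝ] ℝ :=
  momentFunctional (pseudoMoment g b r d) ∘ₗ (MvPolynomial.aeval S).toLinearMap

variable {g b r d S} {c : ℝ}

/-- Unfolding. [cite: Grigoriev2001TCS, Lemma 9] -/
theorem substFunctional_apply (p : MvPolynomial σ ℝ) :
    substFunctional g b r d S p = momentFunctional (pseudoMoment g b r d) (MvPolynomial.aeval S p) :=
  rfl

/-- **Exact identities**: if `P(S) = 0` in `ParityAlg` then `E (g' · P) = 0` for every `g'`.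
[cite: Grigoriev2001TCS, Lemma 9 (proof)] -/
theorem substFunctional_mul_eq_zero_of_aeval_eq_zero (P g' : MvPolynomial σ ℝ)
    (hP : MvPolynomial.aeval S P = 0) : substFunctional g b r d S (g' * P) = 0 := by
  rw [substFunctional_apply, map_mul, hP, mul_zero, map_zero]

variable [DecidableEq ι]

/-- Normalisation `E 1 = 1`. [cite: Grigoriev2001TCS, Lemma 9 (proof)] -/
theorem substFunctional_one (hexp : VecExpands g r c) (hc : 0 < c) (hd : (d : ℝ) ≤ c * r / 2)
    (hr : 0 ≤ r) : substFunctional g b r d S 1 = 1 := by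
  rw [substFunctional_apply, map_one, AddMonoidAlgebra.one_def, momentFunctional_single, one_mul,
    pseudoMoment_zero hexp hc hd hr]

/-- **Positivity**: `E (q²) ≥ 0` whenever `2 Δ deg q ≤ d`. [cite: Grigoriev2001TCS, Lemma 9 (proof) with §2 (the Theorem)] -/
theorem substFunctional_mul_self_nonneg (hexp : VecExpands g r c) (hc : 0 < c)
    (hd : (d : ℝ) ≤ c * r / 2) (hr : 0 ≤ r) (hb : ∀ i, b i * b i = 1) {Δ : ℕ}
    (hS : ∀ e, CardSuppLE Δ (S e)) (q : MvPolynomial σ ℝ) (hq : 2 * (Δ * q.totalDegree) ≤ d) :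
    0 ≤ substFunctional g b r d S (q * q) := by
  rw [substFunctional_apply, map_mul, momentFunctional_mul]
  refine pseudoMoment_quadratic_nonneg hexp hc hd hr hb _ _ fun T hT => ?_
  exact le_trans (Nat.mul_le_mul_left 2 (cardSuppLE_aeval S hS q T hT)) hq

/-- **Parity identities**: if `P(S) = a · (1 + y_D) · w` where `y_D = -1` is the `i`-th XOR
equation (`g i = indVec D`, `b i = -1`), `w` has monomials of size `≤ k`, and
`k + Δ deg g' + |D| ≤ d`, then `E (g' · P) = 0`. [cite: Grigoriev2001TCS, Lemma 9 with Lemma 10 (the Tseitin equations of the reduction)] -/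
theorem substFunctional_mul_eq_zero_of_parity (hexp : VecExpands g r c) (hc : 0 < c)
    (hd : (d : ℝ) ≤ c * r / 2) (hr : 2 ≤ r) (hb : ∀ i, b i * b i = 1) {Δ : ℕ}
    (hS : ∀ e, CardSuppLE Δ (S e)) (i : ι) {D : Finset ℕ} (hgi : g i = indVec D) (hbi : b i = -1)
    (P g' : MvPolynomial σ ℝ) (a : ℝ) (w : ParityAlg) {k : ℕ} (hw : CardSuppLE k w)
    (hP : MvPolynomial.aeval S P = a • ((1 + yMon (indVec D)) * w))
    (hdeg : k + Δ * g'.totalDegree + D.card ≤ d) :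
    substFunctional g b r d S (g' * P) = 0 := by
  rw [substFunctional_apply, map_mul, hP, mul_smul_comm, map_smul,
    show MvPolynomial.aeval S g' * ((1 + yMon (indVec D)) * w) =
      (1 + yMon (indVec D)) * (w * MvPolynomial.aeval S g') by ring,
    momentFunctional_one_add_yMon_mul hexp hc hd hr hb i hgi hbi _ fun T hT => ?_, smul_zero]
  exact le_trans (Nat.add_le_add_right ((hw.mul (cardSuppLE_aeval S hS g')) T hT) _) hdeg

/-- **No static SOS refutation from a reduction (Grigoriev 2001, Lemma 9, dual form).** Let the
XOR system `(g, b)` be `(r, c)`-expanding, `d ≤ c r / 2`, `r ≥ 2`, `b = ±1`, and let `S` substitute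
every variable by an element with monomials of size `≤ Δ`. If under the substitution every
equation of `Sys` either vanishes in `ParityAlg` or becomes `a · (1 + y_D) · w` for an XOR
equation `y_D = -1` of the system with `|w| ≤ k`, `k + 2 Δ d' + |D| ≤ d`, and if `2 Δ d' ≤ d`, then
`Sys` has no static sum-of-squares refutation of half-degree `d'`.
[cite: Grigoriev2001TCS, Lemma 9] -/
theorem not_hasSOSRefutation_of_substitution {κ : Type*} [Fintype κ]
    (Sys : κ → MvPolynomial σ ℝ) (d' : ℕ) (hexp : VecExpands g r c) (hc : 0 < c)
    (hd : (d : ℝ) ≤ c * r / 2) (hr : 2 ≤ r) (hb : ∀ i, b i * b i = 1) {Δ : ℕ}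
    (hS : ∀ e, CardSuppLE Δ (S e)) (hsq : 2 * (Δ * d') ≤ d)
    (hSys : ∀ j, MvPolynomial.aeval S (Sys j) = 0 ∨
      ∃ (i : ι) (D : Finset ℕ) (a : ℝ) (w : ParityAlg) (k : ℕ), g i = indVec D ∧ b i = -1 ∧
        CardSuppLE k w ∧ MvPolynomial.aeval S (Sys j) = a • ((1 + yMon (indVec D)) * w) ∧
        k + Δ * (2 * d') + D.card ≤ d) :
    ¬ Literature.Computability.Complexity.HasSOSRefutation Sys d' := by
  have hr0 : (0 : ℝ) ≤ r := by linarith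
  refine Literature.Computability.Complexity.not_hasSOSRefutation_of_pseudoexpectation
    (substFunctional g b r d S) (substFunctional_one hexp hc hd hr0) (fun q hq => ?_) ?_
  · exact substFunctional_mul_self_nonneg hexp hc hd hr0 hb hS q
      (le_trans (Nat.mul_le_mul_left 2 (Nat.mul_le_mul_left Δ hq)) hsq)
  · intro j g' hdeg
    rcases hSys j with h0 | ⟨i, D, a, w, k, hgi, hbi, hw, hP, hk⟩
    · exact substFunctional_mul_eq_zero_of_aeval_eq_zero _ _ h0
    · refine substFunctional_mul_eq_zero_of_parity hexp hc hd hr hb hS i hgi hbi _ g' a w hw hP ?_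
      have : g'.totalDegree ≤ 2 * d' := le_trans (Nat.le_add_right _ _) hdeg
      exact le_trans (by gcongr) hk

end Subst

end Literature.Computability.MetaComplexity
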